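import Literature.AlgebraicGeometry.Frobenioids.Prop55Sub
import Literature.AlgebraicGeometry.Frobenioids.PerfectionBiratNormalized
import Literature.AlgebraicGeometry.Frobenioids.PerfectionPullbackMorphisms
import Literature.AlgebraicGeometry.Frobenioids.PerfectionProofs
import Literature.AlgebraicGeometry.Frobenioids.PerfectionCoAngular
import Literature.AlgebraicGeometry.Frobenioids.BaseFrobeniusPairFunctorImage
import Literature.AlgebraicGeometry.Frobenioids.BirationalizationIsFrobenioidData
import Literature.AlgebraicGeometry.Frobenioids.ModelFrobenioidModelType
import HarnessLib

/-!
# Frobenioids I, Proposition 5.5 (iii): "if `C` is of … model type, then so is `C^pf`" — the pre-model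
# conjunct for THE perfection and the closing of the MODEL slot of `Prop55Sub.lean` (abc-iut cell, layer L1,
# node `FrdI:Prop5.5(iii)`, sub-DAG row `FrdI:Prop5.5(iii)/P55-L06`, slot `FrdI.Prop55Sub.Prop55iii_pf_model`)

Mochizuki, *The geometry of Frobenioids I: the general theory*, Kyushu J. Math. **62** (2008)
293–400, §5, Proposition 5.5 (iii), kurims text p. 104 ll. 36–37 (statement), proof p. 105 ll. 11–20
[cite: MochizukiFrdI2008, Prop. 5.5 (iii) p.104]:

> "(iii) If `C` is of standard (respectively, rationally standard; model) type, then so is `C^pf`."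
> Proof (p. 105): "… In light of these observations, assertion (iii) for `C^pf` follows immediately from
> the definitions [cf. also Proposition 3.2, (ii), (iii)] …"

PROOF-ONLY companion (no definitions).  "Model type" = pre-model type (Def. 2.7 (iii): `C` admits a
base-Frobenius pair) AND birationally Frobenius-normalized type (Def. 4.5 (i)), exactly as bound in the slot
`FrdI.Prop55Sub.Prop55iii_pf_model F hF` (`Prop55Sub.lean`, seat abc-iut-w4-d084).

* PRE-MODEL CONJUNCT (`Perfection.isOfPreModelType_of`, UNCONDITIONAL; the interface shape (S4) agreed on
  the cell's board): the image under the natural functor `C → C^pf` (Def. 3.1 (iii)) of a base-Frobenius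
  pair of `C` is a base-Frobenius pair of `C^pf → F_{Φ^pf}` — `C → C^pf` lies over `D` on the nose
  (`Perfection.toPfCompBaseIso`), is injective on objects (`(A, 1) = (A', 1) ⇒ A = A'`), and preserves
  pull-back morphisms, morphisms of Frobenius type and Frobenius degrees (Prop. 3.2 (i)(ii): seat
  abc-iut-L1-d9's `isPullbackMorphism_toPf_map`, `preservesMor_isFrobeniusType`, `degFr_toPf`); the
  transport of Def. 2.7 (i)–(iii) along such a functor is `IsOfPreModelType.of_functorImage`
  (`BaseFrobeniusPairFunctorImage.lean`).
* BIRATIONALLY FROBENIUS-NORMALIZED CONJUNCT: seat abc-iut-w5-d042's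
  `PerfectionBirat.isOfBiratFrobeniusNormalizedType_biratData_perfection` (`PerfectionBiratNormalized.lean`:
  Frobenius-normalization REFLECTED along the faithful comparison functor `(C^pf)^birat → (C^birat)^pf` of
  Prop. 5.5 (ii), seat abc-iut-w4-d044), GIVEN that `C^birat` is a Frobenioid (Prop. 4.4 (ii), `hBi`, to FORM
  `(C^birat)^pf`); consumed BY NAME through its closer `FrdI.Prop55Sub.prop55iii_pf_model_of hF hBi hpre`.

CLOSERS.  `FrdI.Prop55Sub.prop55iii_pf_model_of_isFrobenioid_birat hF hBi : Prop55iii_pf_model F hF` —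
the slot with its pre-model conjunct DISCHARGED, CONDITIONAL on Prop. 4.4 (ii) only (cone node
`FrdI:Prop4.4(ii)`, the same binder the sibling statement `Prop55ii_birat` carries).  Prop. 4.4 (ii) is in
turn DISCHARGED in the tree for `C` of ISOTROPIC and birationally Frobenius-normalized type (seat
abc-iut-w5-d227, `isFrobenioid_biratData_ops_toFunctor'`, the author's 2024 corrected form of Prop. 4.4
(ii)), and birational Frobenius-normalization of `C` is the slot's own hypothesis; whence
`FrdI.Prop55Sub.prop55iii_pf_model_of_isOfIsotropicType hF hiso : Prop55iii_pf_model F hF`, CONDITIONAL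
ONLY on print's standing hypothesis "`C` is of isotropic type" of Def. 2.7 / Def. 4.5 (i) ("of model
[hence, in particular, isotropic …] type", p. 105 l. 31), which the typed predicate `IsOfPreModelType`
does not bundle.  No statement of the paper is strengthened; nothing here bears on [IUTchIII] Cor. 3.12.
-/

namespace Literature.AlgebraicGeometry.Frobenioids

open CategoryTheory Opposite

universe w v v' u u'

namespace PreFrobenioid

variable {D : Type u} [Category.{v} D] {Φ : Dᵒᵖ ⥤ CommMonCat.{w}}
  {C : Type u'} [Category.{v'} C] {F : C ⥤ ElemFrobenioid Φ}

/-! ### The pre-model conjunct: `C → C^pf` carries base-Frobenius pairs to base-Frobenius pairs -/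

namespace Perfection

/-- `C → C^pf` is injective on objects (`(A, 1) = (A', 1)` forces `A = A'`), a fortiori detects objects up to
isomorphism. [cite: MochizukiFrdI2008, Def. 3.1 (iii) p.57] -/
theorem nonempty_iso_of_toPf_obj_eq (hF : IsFrobenioid F) ⦃A A' : C⦄ (h : (toPf hF).obj A = (toPf hF).obj A') :
    Nonempty (A ≅ A') :=
  ⟨eqToIso (congrArg Perfection.obj h : A = A')⟩

/-- **Prop. 5.5 (iii), model clause, PRE-MODEL CONJUNCT (unconditional)**: if `C` is of pre-model type
(Def. 2.7 (iii)) then so is `C^pf → F_{Φ^pf}` — the image under `C → C^pf` of a base-Frobenius pair of `C` is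
a base-Frobenius pair of `C^pf` ("follows immediately from the definitions", p. 105 l. 17, with Prop. 3.2
(i)(ii) supplying that `C → C^pf` lies over `D` and preserves pull-back morphisms, morphisms of Frobenius
type and Frobenius degrees). [cite: MochizukiFrdI2008, Prop. 5.5 (iii) p.104] -/
theorem isOfPreModelType_of (hF : IsFrobenioid F) (h : IsOfPreModelType F) :
    IsOfPreModelType (ops hF).toFunctor :=
  IsOfPreModelType.of_functorImage F (ops hF).toFunctor (toPf hF) toPfCompBaseIso
    (nonempty_iso_of_toPf_obj_eq hF)
    (fun _ _ _ hφ => (PreFrobenioidData.ofFunctor_isPullbackMorphism (ops hF).toFunctor _).mp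
      (isPullbackMorphism_toPf_map hφ))
    (fun _ _ φ hφ => (PreFrobenioidData.isFrobeniusType_toFunctor_iff (ops hF) _).mpr
      (preservesMor_isFrobeniusType hF φ ((PreFrobenioidData.ofFunctor_isFrobeniusType F φ).mpr hφ)))
    (fun _ _ φ => degFr_toPf φ) h

/-- The same with the base-Frobenius pair of `C^pf` EXHIBITED as the image of the given one: for a
base-Frobenius pair `(P, F)` of `C` there is a base-Frobenius pair `(P^pf, F^pf)` of `C^pf` whose objects and
arrows are the images `(A, 1)`, `[f]` of those of `P` and with `F^pf(n)_{(A,1)} = [F(n)_A]`.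
[cite: MochizukiFrdI2008, Prop. 5.5 (iii) p.104] -/
theorem exists_isBaseFrobeniusPair_image (hF : IsFrobenioid F) {P : Presection C} {Fr : ℕ+ →* End P.ι}
    (hPF : IsBaseFrobeniusPair F P Fr) :
    ∃ (P' : Presection (Perfection hF)) (Fr' : ℕ+ →* End P'.ι)
      (hobj : ∀ A : C, P.obj A → P'.obj ((toPf hF).obj A)),
      (∀ ⦃A B : C⦄ (f : A ⟶ B), P.hom f → P'.hom ((toPf hF).map f)) ∧
      IsBaseFrobeniusPair (ops hF).toFunctor P' Fr' ∧
        ∀ (n : ℕ+) (A : C) (hA : P.obj A),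
          (toPf hF).map ((Fr n).app ⟨A, hA⟩) = (Fr' n).app ⟨(toPf hF).obj A, hobj A hA⟩ :=
  hPF.functorImage F (ops hF).toFunctor (toPf hF) toPfCompBaseIso (nonempty_iso_of_toPf_obj_eq hF)
    (fun _ _ _ hφ => (PreFrobenioidData.ofFunctor_isPullbackMorphism (ops hF).toFunctor _).mp
      (isPullbackMorphism_toPf_map hφ))
    (fun _ _ φ hφ => (PreFrobenioidData.isFrobeniusType_toFunctor_iff (ops hF) _).mpr
      (preservesMor_isFrobeniusType hF φ ((PreFrobenioidData.ofFunctor_isFrobeniusType F φ).mpr hφ)))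
    (fun _ _ φ => degFr_toPf φ)

end Perfection

end PreFrobenioid

/-! ### Proposition 5.5 (iii), first sentence, "model": the slot of `Prop55Sub.lean` -/

namespace FrdI.Prop55Sub

open PreFrobenioid

variable {D : Type u} [Category.{v} D] {Φ : Dᵒᵖ ⥤ CommMonCat.{w}}
  {C : Type u'} [Category.{v'} C] {F : C ⥤ ElemFrobenioid Φ}

/-- **Proposition 5.5 (iii), "if `C` is of … model type, then so is `C^pf`"** — the slot
`Prop55iii_pf_model F hF` with its pre-model conjunct DISCHARGED (`Perfection.isOfPreModelType_of`), GIVEN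
that `C^birat → F_{0_D}` is a Frobenioid ([FrdI] Prop. 4.4 (ii), hypothesis `hBi`, cone node
`FrdI:Prop4.4(ii)` consumed BY NAME — needed to FORM `(C^birat)^pf` in the birational conjunct, seat
abc-iut-w5-d042's `prop55iii_pf_model_of`).  CONDITIONAL on Prop. 4.4 (ii) only.
[cite: MochizukiFrdI2008, Prop. 5.5 (iii) p.104] -/
theorem prop55iii_pf_model_of_isFrobenioid_birat (hF : IsFrobenioid F)
    (hBi : IsFrobenioid (biratOps hF (hasBiratSquares_of_isFrobenioid hF)).toFunctor) :
    Prop55iii_pf_model F hF :=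
  prop55iii_pf_model_of hF hBi (Perfection.isOfPreModelType_of hF)

/-- **Proposition 5.5 (iii), "if `C` is of … model type, then so is `C^pf`", for `C` of ISOTROPIC type** —
the slot `Prop55iii_pf_model F hF` with BOTH residual hypotheses discharged: for `C` isotropic and (by the
slot's own hypothesis) birationally Frobenius-normalized, `C^birat → F_{0_D}` is a Frobenioid (seat
abc-iut-w5-d227, `isFrobenioid_biratData_ops_toFunctor'`, the author's 2024 form of Prop. 4.4 (ii); the two
renderings of Def. 4.5 (i) agree by `isBiratFrobeniusNormalized_iff_biratData`).  CONDITIONAL only on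
"`C` is of isotropic type", print's standing hypothesis for (pre-)model type (Def. 2.7; "of model [hence, in
particular, isotropic] type", p. 105 l. 31), which the typed `IsOfPreModelType` does not bundle.
[cite: MochizukiFrdI2008, Prop. 5.5 (iii) p.104] -/
theorem prop55iii_pf_model_of_isOfIsotropicType (hF : IsFrobenioid F) (hiso : IsOfIsotropicType F) :
    Prop55iii_pf_model F hF := fun hfi hfn hPf h =>
  prop55iii_pf_model_of_isFrobenioid_birat hF
    (isFrobenioid_biratData_ops_toFunctor' hF hiso fun A =>
      (isBiratFrobeniusNormalized_iff_biratData A).mpr (h.2.obj A))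
    hfi hfn hPf h

end FrdI.Prop55Sub

end Literature.AlgebraicGeometry.Frobenioids
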